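import Literature.AlgebraicGeometry.HodgeTheory.DirectImageTransport
import Literature.AlgebraicTopology.SingularHomology.CohomologyHomotopyInvariance
import HarnessLib

/-!
# Transport in `Rᵏ π_* ℂ` along a path covered by a continuous family of fibre maps is the induced map
# (Voisin I §9.2.1: the local system is trivialised by any `C⁰` trivialisation of the family)

Family `hodge`, layer `Literature/AlgebraicGeometry/HodgeTheory`; theorems only (no definition, no named fact).
Continuation of `DirectImageTransport` (transport `transportFun π k hU γ` in the espace étalé `FiberClass π k` of
`Rᵏ π_* ℂ|_U`, characterised by continuous lifts, `transportFun_eq_of_continuous`). Let `γ : [0,1] → U` be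
continuous and let `h_u : Y → X_{γ(u)}(ℂ)`, `u ∈ [0,1]`, be continuous maps from a fixed space `Y` into the
fibres, JOINTLY continuous as a map `Y × [0,1] → 𝒳(ℂ)` (a "fibrewise isotopy" over `γ`: e.g. the restrictions
of a `C⁰` trivialisation `X_s × [0,1] ≅ γ^* 𝒳`, or an algebraic torus acting on the family), each injective on
`Hᵏ` (e.g. homeomorphisms). Then:

* `FiberClass.continuous_of_isotopy` — **a family of fibre classes `c_u ∈ Hᵏ(X_{γ u}(ℂ); ℂ)` with CONSTANT
  pull-back `h_u^* c_u = a ∈ Hᵏ(Y; ℂ)` is a continuous section of the espace étalé over `γ`.** Proof: over a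
  trivialising ball `B ∋ γ(u₀)` (`IsCohomologicallyLocallyTrivialOn`) take the tube class `ξ` with
  `ξ|_{γ u₀} = c_{u₀}`; for `u` near `u₀` the maps `Y → π⁻¹B(ℂ)`, `y ↦ h_u(y)` and `y ↦ h_{u₀}(y)` are homotopic
  through the family (the parameter interval is convex), so by homotopy invariance of singular cohomology
  (`singularCohomology.map_eq_of_homotopic'`) `h_u^*(ξ|_{γ u}) = h_{u₀}^*(ξ|_{γ u₀}) = a = h_u^* c_u`, whence
  `ξ|_{γ u} = c_u`: the family is locally the local section of `ξ`.
* `transportFun_eq_of_isotopy` — hence **transport along `γ` takes `c_0` to `c_1`** ("the monodromy of a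
  trivialised family is the holonomy of the trivialisation"): for a loop covered by fibre homeomorphisms with
  `h_0 = id`, the monodromy is `(h_1^*)⁻¹`.

Written by the prover seat `hodge-nonav-prover-Bx` (g8) for the route `CyclicUnitaryPowers` of the Hodge summit, where
the scalar loop `t ↦ e^{2πit}·f` of the universal family of cyclic covers `x₃^p = f` is covered by the isotopy
`x₃ ↦ e^{2πit/p} x₃`, whose holonomy is the deck transformation (so the covering automorphism is a monodromy
transformation, and monodromy invariants are deck invariants — the cited fact
`carlsonToledo1999_monodromyInvariants_eq_deckInvariants`).

## References

* [VoisinHodgeI2002] C. Voisin, Hodge Theory and Complex Algebraic Geometry I, CUP 2002, §9.2.1 (the local system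
  `Rᵏ π_* A` and its trivialisation over contractible opens by Ehresmann's theorem, Thm. 9.3) and Prop. 9.5.
* [HatcherAT2002] A. Hatcher, Algebraic Topology, CUP 2002, §3.1 p. 201 (homotopy invariance of cohomology),
  §1.3 Prop. 1.30/1.34 (path lifting).
-/

noncomputable section

open CategoryTheory
open _root_.Topology _root_.Filter
open Literature.AlgebraicTopology.SingularHomology
open scoped unitInterval

namespace Literature.AlgebraicGeometry.HodgeTheory

section HodgeTheory

variable {𝒳 S : Motives.SchemeOver ℂ} (π : 𝒳 ⟶ S) (k : ℕ) {U : Set (Motives.ComplexPoints S)}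

/-- **A family of fibre classes with constant pull-back under a fibrewise isotopy is a continuous section of
the espace étalé of `Rᵏ π_* ℂ`.** Data: a cohomologically locally trivial `U`; a continuous `γ : [0,1] → S(ℂ)`
with values in `U`; continuous maps `h u : Y → X_{γ u}(ℂ)` jointly continuous into `𝒳(ℂ)`; each `h_u^*`
injective on `Hᵏ`; classes `c u ∈ Hᵏ(X_{γ u}(ℂ); ℂ)` with `h_u^* (c u) = a` for all `u`. Conclusion:
`u ↦ (γ u, c u)` is continuous in `FiberClass π k`. [cite: VoisinHodgeI2002, §9.2.1 and Prop. 9.5]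
[cite: HatcherAT2002, §3.1 p. 201] -/
theorem FiberClass.continuous_of_isotopy (hU : IsCohomologicallyLocallyTrivialOn π U)
    {Y : Type} [TopologicalSpace Y] (γ : C(I, Motives.ComplexPoints S)) (hγ : ∀ u, γ u ∈ U)
    (h : ∀ u : I, C(Y, Motives.ComplexPoints (Motives.fiberOver π (γ u))))
    (hcont : Continuous fun yu : Y × I =>
      Motives.AlgPoints.map (Motives.fiberι π (γ yu.2)) (h yu.2 yu.1))
    (hinj : ∀ u, Function.Injective (singularCohomology.map ℂ ℂ (h u) k))
    (c : ∀ u : I, complexBetti (Motives.fiberOver π (γ u)) k) (a : singularCohomology ℂ ℂ Y k)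
    (hc : ∀ u, singularCohomology.map ℂ ℂ (h u) k (c u) = a) :
    Continuous fun u : I => (⟨γ u, c u⟩ : FiberClass π k) := by
  rw [continuous_iff_continuousAt]
  intro u₀
  -- a trivialising open `B ∋ γ u₀` and the tube class over it restricting to `c u₀`
  obtain ⟨B, hBo, hu₀B, -, -, hbij⟩ := hU.exists_nhds_bijective (hγ u₀) Set.univ univ_mem
  obtain ⟨ξ, hξ⟩ := (hbij k hu₀B).2 (c u₀)
  -- a ball around `u₀` mapped into `B`
  have hJ : γ ⁻¹' B ∈ 𝓝 u₀ := γ.continuous.continuousAt.preimage_mem_nhds (hBo.mem_nhds hu₀B)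
  obtain ⟨ε, hε, hball⟩ := Metric.mem_nhds_iff.mp hJ
  refine FiberClass.continuousAt_of_eventually_eq_tubeSection γ.continuous.continuousAt hBo ξ ?_
  filter_upwards [Metric.ball_mem_nhds u₀ hε] with u hu
  have huB : γ u ∈ B := hball hu
  refine ⟨huB, ?_⟩
  -- the segment `τ ↦ (1 − τ) u₀ + τ u` in `[0, 1]`, inside the ball
  have hmemI : ∀ τ : I, (1 - (τ : ℝ)) * (u₀ : ℝ) + (τ : ℝ) * (u : ℝ) ∈ I := fun τ =>
    ⟨by nlinarith [u₀.2.1, u₀.2.2, u.2.1, u.2.2, τ.2.1, τ.2.2],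
      by nlinarith [u₀.2.1, u₀.2.2, u.2.1, u.2.2, τ.2.1, τ.2.2]⟩
  let segPoint : I → I := fun τ => ⟨(1 - (τ : ℝ)) * (u₀ : ℝ) + (τ : ℝ) * (u : ℝ), hmemI τ⟩
  have hsegval : ∀ τ : I, ((segPoint τ : I) : ℝ) = (1 - (τ : ℝ)) * (u₀ : ℝ) + (τ : ℝ) * (u : ℝ) :=
    fun _ => rfl
  have segPoint_zero : segPoint 0 = u₀ := Subtype.ext (by rw [hsegval]; simp)
  have segPoint_one : segPoint 1 = u := Subtype.ext (by rw [hsegval]; simp)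
  have continuous_segPoint : Continuous segPoint :=
    Continuous.subtype_mk (by fun_prop) _
  have hsegB : ∀ τ : I, γ (segPoint τ) ∈ B := fun τ => by
    refine hball (Metric.mem_ball.mpr (lt_of_le_of_lt ?_ (Metric.mem_ball.mp hu)))
    rw [Subtype.dist_eq, Subtype.dist_eq, Real.dist_eq, Real.dist_eq, hsegval]
    have hτ : (1 - (τ : ℝ)) * (u₀ : ℝ) + (τ : ℝ) * (u : ℝ) - (u₀ : ℝ) = (τ : ℝ) * ((u : ℝ) - (u₀ : ℝ)) := by
      ring
    rw [hτ, abs_mul, abs_of_nonneg τ.2.1]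
    exact mul_le_of_le_one_left (abs_nonneg _) τ.2.2
  let G : ∀ v : I, γ v ∈ B → C(Y, tubeOver π B) := fun v hv => (fiberToTube π hv).comp (h v)
  have hG : ∀ (v : I) (hv : γ v ∈ B), singularCohomology.map ℂ ℂ (G v hv) k ξ =
      singularCohomology.map ℂ ℂ (h v) k (fiberRestrict π hv k ξ) := by
    intro v hv
    change singularCohomology.map ℂ ℂ ((fiberToTube π hv).comp (h v)) k ξ = _
    rw [singularCohomology.map_comp, ModuleCat.comp_apply]
    rfl
  -- the homotopy `G u₀ ≃ G u` through the segment
  have hGval : ∀ (v : I) (hv : γ v ∈ B) (y : Y),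
      ((G v hv y : tubeOver π B) : Motives.ComplexPoints 𝒳) =
        Motives.AlgPoints.map (Motives.fiberι π (γ v)) (h v y) := fun _ _ _ => rfl
  let Hfun : I × Y → tubeOver π B := fun τy =>
    ⟨Motives.AlgPoints.map (Motives.fiberι π (γ (segPoint τy.1))) (h (segPoint τy.1) τy.2),
      map_fiberι_mem_tubeOver π (hsegB τy.1) _⟩
  have hHval : ∀ τy : I × Y, ((Hfun τy : tubeOver π B) : Motives.ComplexPoints 𝒳) =
      Motives.AlgPoints.map (Motives.fiberι π (γ (segPoint τy.1))) (h (segPoint τy.1) τy.2) :=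
    fun _ => rfl
  have hHcont : Continuous Hfun :=
    Continuous.subtype_mk
      (hcont.comp (continuous_snd.prodMk (continuous_segPoint.comp continuous_fst))) _
  have hH0 : ∀ y, Hfun (0, y) = G u₀ hu₀B y := fun y => by
    apply Subtype.ext
    rw [hGval, hHval]
    change Motives.AlgPoints.map (Motives.fiberι π (γ (segPoint 0))) (h (segPoint 0) y) = _
    rw [segPoint_zero]
  have hH1 : ∀ y, Hfun (1, y) = G u huB y := fun y => by
    apply Subtype.ext
    rw [hGval, hHval]
    change Motives.AlgPoints.map (Motives.fiberι π (γ (segPoint 1))) (h (segPoint 1) y) = _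
    rw [segPoint_one]
  let H : ContinuousMap.Homotopy (G u₀ hu₀B) (G u huB) :=
    { toFun := Hfun
      continuous_toFun := hHcont
      map_zero_left := hH0
      map_one_left := hH1 }
  have hhom : singularCohomology.map ℂ ℂ (G u₀ hu₀B) k = singularCohomology.map ℂ ℂ (G u huB) k :=
    singularCohomology.map_eq_of_homotopic' ℂ ℂ ⟨H⟩ k
  -- compare `ξ|_{γ u}` and `c u` through the injective `h_u^*`
  have hkey : fiberRestrict π huB k ξ = c u := by
    apply hinj u
    rw [hc u, ← hG u huB, ← hhom, hG u₀ hu₀B, hξ, hc u₀]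
  change (⟨γ u, c u⟩ : FiberClass π k) = ⟨γ u, fiberRestrict π huB k ξ⟩
  rw [hkey]

/-- **Transport along a path covered by a fibrewise isotopy is the holonomy of the isotopy**: with the data of
`FiberClass.continuous_of_isotopy` over a path `γ` from `s` to `t` in `U`, transport along `γ` takes the class
`c 0` (on `X_s`) to `c 1` (on `X_t`) — the endpoint identifications being recorded as equalities of fibre
classes, as in `transportFun_eq_of_continuous`. In particular, for a loop at `s` covered by fibre
homeomorphisms `h_u` with `h_0 = id`, the monodromy is `(h_1^*)⁻¹`. [cite: VoisinHodgeI2002, §9.2.1 and Prop. 9.5]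
[cite: HatcherAT2002, §1.3 Prop. 1.34] -/
theorem transportFun_eq_of_isotopy (hU : IsCohomologicallyLocallyTrivialOn π U)
    {Y : Type} [TopologicalSpace Y] {s t : U} (γ : Path s t)
    (h : ∀ u : I, C(Y, Motives.ComplexPoints (Motives.fiberOver π (γ u).1)))
    (hcont : Continuous fun yu : Y × I =>
      Motives.AlgPoints.map (Motives.fiberι π (γ yu.2).1) (h yu.2 yu.1))
    (hinj : ∀ u, Function.Injective (singularCohomology.map ℂ ℂ (h u) k))
    (c : ∀ u : I, complexBetti (Motives.fiberOver π (γ u).1) k) (a : singularCohomology ℂ ℂ Y k)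
    (hc : ∀ u, singularCohomology.map ℂ ℂ (h u) k (c u) = a)
    {α : complexBetti (Motives.fiberOver π s.1) k} {β : complexBetti (Motives.fiberOver π t.1) k}
    (h0 : (⟨(γ 0).1, c 0⟩ : FiberClass π k) = ⟨s.1, α⟩)
    (h1 : (⟨(γ 1).1, c 1⟩ : FiberClass π k) = ⟨t.1, β⟩) :
    transportFun π k hU ⟦γ⟧ α = β :=
  transportFun_eq_of_continuous π k hU γ c
    (FiberClass.continuous_of_isotopy π k hU
      (⟨fun u => (γ u).1, continuous_subtype_val.comp γ.continuous⟩) (fun u => (γ u).2) h hcont hinj c a hc)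
    h0 h1

end HodgeTheory

end Literature.AlgebraicGeometry.HodgeTheory

end
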